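import Summits.QuantumFields.YangMills.Theorems.BalabanLadderIRPinnedExitCofinal
import HarnessLib

/-!
# Crux `BalabanLadder.IR` ∕ `IRcof` (stmt-QuantumFields-19354 ∕ 26930): the registered tolerance `1/24` of the pinned bills is a
# REPRESENTATIVE — PX(θ) and PXcof(θ) do not depend on `θ ∈ (0, 1/24]` (helper; LEAD prover ym-ir-line-ab-p1 gen 6, slot custody)

HONEST STATUS.  Bookkeeping over the landed purity climb; nothing here proves PX(1/24), PXcof(1/24) (THE NUMBER), `BalabanLadder.IR`
(19354), `IRcof` (26930), or the Clay Yang–Mills mass gap (R4 = the conditional finite-𝕋⁴ rung `BalabanLadder.UV` only).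

The two slots of record register `stub_pinnedExit96 : PinnedExit96.PinnedExitAt (1/24)` (19354) and
`stub_pinnedExitsCofinal : PinnedExitsCofinalAt (1/24)` (26930; the cofinal body, spelled out below exactly as in
`IR/Negative/PinnedExitVacuityThreshold.lean` and `PinnedExitCofinal.pinnedExitsCofinal_of_pinnedExitAt`).  Calibrations of record:
`pinnedExitAt_of_one_le` (θ ≥ 1 trivially TRUE, p619144) and `not_pinnedExitAtFree` (θ ≤ 1/24 FALSE without the floor, p624174).
THIS FILE: below the registered tolerance NOTHING changes —

* `pinnedExitAt_mono` ∕ `pinnedExitsCofinalAt_mono` — larger tolerance is weaker (trivial);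
* `pinnedExitAt_of_24` ∕ `pinnedExitsCofinalAt_of_24` — **PX(1/24) ⇒ PX(θ) and PXcof(1/24) ⇒ PXcof(θ) for EVERY `θ > 0`**: a 96 %-pure pinned
  box at `L` becomes an `e^{−m}`-pure box at `m·2¹⁴·L` by the landed explicit window `PinnedExit96.coldDefect_window_exp` (purity climb
  `coldDefect_widen_24` + coupling-axis decay), and the pin survives with `T ↦ m·2¹⁴·T`, `m = max 2 ⌈−log θ⌉₊` (no new definition); the threshold moves to
  `max β₁ 0` (the climb is stated for `β ≥ 0`);
* `pinnedExitAt_iff_24` ∕ `pinnedExitsCofinalAt_iff_24` — hence **PX(θ) ↔ PX(1/24) and PXcof(θ) ↔ PXcof(1/24) for all `0 < θ ≤ 1/24`**: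
  the registered number `1/24` is the LARGEST tolerance inside the squaring basin of the landed sharp recursion, not a choice that
  strengthens or weakens the obligation; every instrument row of `pub/ym-ir/FINITE-BOX-PURITY.md` at any tolerance `≤ 1/24` tests the same stub.

References: tree `BalabanLadderIRPinnedExit96` (`coldDefect_window_exp`, idea-14 ∕ LEAD g5), `BalabanLadderIRPurityClimb24`,
`BalabanLadderIRCouplingAxisTransport`; M. Lüscher, Commun. Math. Phys. 104 (1986) 177 (finite-volume purity ∕ spectrum, background only).
-/

noncomputable section

open Filter Topology
open Literature.MathematicalPhysics.QuantumFieldTheory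
open Summit.QuantumFields.YangMills.Cruxes.OSLegsFromFemtoAndGap.DlrCollarTransfer (LowerBounds)
open Summit.QuantumFields.YangMills.Cruxes.IR.ColdPurityBridge (coldDefect)
open Summit.QuantumFields.YangMills.Cruxes.IR.PinnedExit96 (PinnedExitAt coldDefect_window_exp)

namespace Summit.QuantumFields.YangMills.Cruxes.IR.PinnedExit96.Tolerance

/-! ## §1 The explicit re-pinning step -/

section Model

variable {G : Type} [Group G] [TopologicalSpace G] [IsTopologicalGroup G] [CompactSpace G]
  [MeasurableSpace G] [BorelSpace G]

/-- `e^{−m(θ)} ≤ θ` for the window multiplier `m(θ) = max 2 ⌈−log θ⌉₊`, `θ > 0`. -/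
theorem exp_neg_windowMult_le {θ : ℝ} (hθ : 0 < θ) : Real.exp (-((max 2 ⌈-Real.log θ⌉₊ : ℕ) : ℝ)) ≤ θ := by
  rw [← Real.le_log_iff_exp_le hθ]
  have h1 : -Real.log θ ≤ (⌈-Real.log θ⌉₊ : ℝ) := Nat.le_ceil _
  have h2 : ((⌈-Real.log θ⌉₊ : ℕ) : ℝ) ≤ ((max 2 ⌈-Real.log θ⌉₊ : ℕ) : ℝ) := by exact_mod_cast le_max_right _ _
  linarith

/-- **Re-pinning step (PROVED)**: at `β ≥ 0`, a `1/24`-pure cold box of side `L ≥ 8` pinned by `a·L ≤ T` yields, for every `θ > 0`, a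
`θ`-pure cold box of side `m(θ)·2¹⁴·L ≥ 8` pinned by `a·L' ≤ m(θ)·2¹⁴·T`, `m(θ) = max 2 ⌈−log θ⌉₊` (landed `coldDefect_window_exp`). -/
theorem repin {r : LatticeRep G} {β a T θ : ℝ} (hβ0 : 0 ≤ β) (hθ : 0 < θ) {L : ℕ} (hL : 8 ≤ L)
    (hpin : a * (L : ℝ) ≤ T) (hδ : coldDefect r.ρ β L ≤ 1 / 24) :
    ∃ L' : ℕ, 8 ≤ L' ∧ a * (L' : ℝ) ≤ ((max 2 ⌈-Real.log θ⌉₊ : ℕ) : ℝ) * 16384 * T ∧ coldDefect r.ρ β L' ≤ θ := by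
  set m : ℕ := max 2 ⌈-Real.log θ⌉₊ with hm
  have hm2 : 2 ≤ m := le_max_left _ _
  refine ⟨m * (16384 * L), ?_, ?_, ?_⟩
  · calc 8 ≤ L := hL
      _ ≤ m * (16384 * L) := by nlinarith
  · have hm0 : (0 : ℝ) ≤ (m : ℝ) * 16384 := by positivity
    have h := mul_le_mul_of_nonneg_left hpin hm0
    calc a * ((m * (16384 * L) : ℕ) : ℝ) = (m : ℝ) * 16384 * (a * (L : ℝ)) := by push_cast; ring
      _ ≤ (m : ℝ) * 16384 * T := h
  · exact (coldDefect_window_exp r hβ0 hL hδ hm2).trans (exp_neg_windowMult_le hθ)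

end Model

/-! ## §2 PX(θ): the slot of record on 19354 is tolerance-invariant on `(0, 1/24]` -/

/-- Larger tolerance is weaker: `θ ≤ θ' → PX(θ) → PX(θ')`. -/
theorem pinnedExitAt_mono {θ θ' : ℝ} (hθ : θ ≤ θ') (h : PinnedExitAt θ) : PinnedExitAt θ' := by
  intro G _ _ _ _ hG hsc
  letI : MeasurableSpace G := borel G
  haveI : BorelSpace G := ⟨rfl⟩
  intro r a ha ha0 hlb
  obtain ⟨T, β₁, hP⟩ := h G hG hsc r a ha ha0 hlb
  exact ⟨T, β₁, fun β hβ => by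
    obtain ⟨L, h8, hp, hd⟩ := hP β hβ
    exact ⟨L, h8, hp, hd.trans hθ⟩⟩

/-- **PX(1/24) ⇒ PX(θ) for every `θ > 0` (PROVED)**: pin `T ↦ m(θ)·2¹⁴·T`, threshold `β₁ ↦ max β₁ 0`. -/
theorem pinnedExitAt_of_24 {θ : ℝ} (hθ : 0 < θ) (h : PinnedExitAt (1 / 24)) : PinnedExitAt θ := by
  intro G _ _ _ _ hG hsc
  letI : MeasurableSpace G := borel G
  haveI : BorelSpace G := ⟨rfl⟩
  intro r a ha ha0 hlb
  obtain ⟨T, β₁, hP⟩ := h G hG hsc r a ha ha0 hlb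
  refine ⟨((max 2 ⌈-Real.log θ⌉₊ : ℕ) : ℝ) * 16384 * T, max β₁ 0, fun β hβ => ?_⟩
  obtain ⟨L, h8, hp, hd⟩ := hP β ((le_max_left _ _).trans hβ)
  exact repin ((le_max_right _ _).trans hβ) hθ h8 hp hd

/-- **PX(θ) ↔ PX(1/24) for all `0 < θ ≤ 1/24`**: the registered tolerance is a representative. -/
theorem pinnedExitAt_iff_24 {θ : ℝ} (hθ0 : 0 < θ) (hθ : θ ≤ 1 / 24) : PinnedExitAt θ ↔ PinnedExitAt (1 / 24) :=
  ⟨pinnedExitAt_mono hθ, pinnedExitAt_of_24 hθ0⟩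

/-- Any two tolerances in `(0, 1/24]` give the same PX. -/
theorem pinnedExitAt_iff_of_mem {θ θ' : ℝ} (hθ0 : 0 < θ) (hθ : θ ≤ 1 / 24) (hθ0' : 0 < θ') (hθ' : θ' ≤ 1 / 24) :
    PinnedExitAt θ ↔ PinnedExitAt θ' :=
  (pinnedExitAt_iff_24 hθ0 hθ).trans (pinnedExitAt_iff_24 hθ0' hθ').symm

/-! ## §3 PXcof(θ): the slot of record on 26930 is tolerance-invariant on `(0, 1/24]`

The cofinal body is spelled out (its `def PinnedExitsCofinalAt` lives in the slot's `Lines/` workfile); it is VERBATIM the conclusion of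
the landed `PinnedExitCofinal.pinnedExitsCofinal_of_pinnedExitAt` and the hypothesis of `PinnedExitCofinal.ircofSC_of_pinnedExitsCofinal_le`. -/

/-- Larger tolerance is weaker, cofinal body. -/
theorem pinnedExitsCofinalAt_mono {θ θ' : ℝ} (hθ : θ ≤ θ')
    (h : ∀ (G : Type) [Group G] [TopologicalSpace G] [IsTopologicalGroup G] [CompactSpace G],
      IsCompactSimpleLieGroup G → SimplyConnectedSpace G →
      letI : MeasurableSpace G := borel G
      haveI : BorelSpace G := ⟨rfl⟩
      ∀ (r : LatticeRep G) (a : ℝ → ℝ), (∀ β, 0 < a β) → Tendsto a atTop (𝓝 0) → LowerBounds G r a →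
        ∃ T : ℝ, ∀ β₁ : ℝ, ∃ β : ℝ, β₁ ≤ β ∧ ∃ L : ℕ, 8 ≤ L ∧ a β * (L : ℝ) ≤ T ∧ coldDefect r.ρ β L ≤ θ) :
    ∀ (G : Type) [Group G] [TopologicalSpace G] [IsTopologicalGroup G] [CompactSpace G],
      IsCompactSimpleLieGroup G → SimplyConnectedSpace G →
      letI : MeasurableSpace G := borel G
      haveI : BorelSpace G := ⟨rfl⟩
      ∀ (r : LatticeRep G) (a : ℝ → ℝ), (∀ β, 0 < a β) → Tendsto a atTop (𝓝 0) → LowerBounds G r a →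
        ∃ T : ℝ, ∀ β₁ : ℝ, ∃ β : ℝ, β₁ ≤ β ∧ ∃ L : ℕ, 8 ≤ L ∧ a β * (L : ℝ) ≤ T ∧ coldDefect r.ρ β L ≤ θ' := by
  intro G _ _ _ _ hG hsc
  letI : MeasurableSpace G := borel G
  haveI : BorelSpace G := ⟨rfl⟩
  intro r a ha ha0 hlb
  obtain ⟨T, hP⟩ := h G hG hsc r a ha ha0 hlb
  exact ⟨T, fun β₁ => by
    obtain ⟨β, hβ, L, h8, hp, hd⟩ := hP β₁
    exact ⟨β, hβ, L, h8, hp, hd.trans hθ⟩⟩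

/-- **PXcof(1/24) ⇒ PXcof(θ) for every `θ > 0` (PROVED)**, cofinal body: ask the cofinal witness beyond `max β₁ 0` and re-pin by `repin`. -/
theorem pinnedExitsCofinalAt_of_24 {θ : ℝ} (hθ : 0 < θ)
    (h : ∀ (G : Type) [Group G] [TopologicalSpace G] [IsTopologicalGroup G] [CompactSpace G],
      IsCompactSimpleLieGroup G → SimplyConnectedSpace G →
      letI : MeasurableSpace G := borel G
      haveI : BorelSpace G := ⟨rfl⟩
      ∀ (r : LatticeRep G) (a : ℝ → ℝ), (∀ β, 0 < a β) → Tendsto a atTop (𝓝 0) → LowerBounds G r a →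
        ∃ T : ℝ, ∀ β₁ : ℝ, ∃ β : ℝ, β₁ ≤ β ∧ ∃ L : ℕ, 8 ≤ L ∧ a β * (L : ℝ) ≤ T ∧ coldDefect r.ρ β L ≤ 1 / 24) :
    ∀ (G : Type) [Group G] [TopologicalSpace G] [IsTopologicalGroup G] [CompactSpace G],
      IsCompactSimpleLieGroup G → SimplyConnectedSpace G →
      letI : MeasurableSpace G := borel G
      haveI : BorelSpace G := ⟨rfl⟩
      ∀ (r : LatticeRep G) (a : ℝ → ℝ), (∀ β, 0 < a β) → Tendsto a atTop (𝓝 0) → LowerBounds G r a →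
        ∃ T : ℝ, ∀ β₁ : ℝ, ∃ β : ℝ, β₁ ≤ β ∧ ∃ L : ℕ, 8 ≤ L ∧ a β * (L : ℝ) ≤ T ∧ coldDefect r.ρ β L ≤ θ := by
  intro G _ _ _ _ hG hsc
  letI : MeasurableSpace G := borel G
  haveI : BorelSpace G := ⟨rfl⟩
  intro r a ha ha0 hlb
  obtain ⟨T, hP⟩ := h G hG hsc r a ha ha0 hlb
  refine ⟨((max 2 ⌈-Real.log θ⌉₊ : ℕ) : ℝ) * 16384 * T, fun β₁ => ?_⟩
  obtain ⟨β, hβ, L, h8, hp, hd⟩ := hP (max β₁ 0)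
  obtain ⟨L', h8', hp', hd'⟩ := repin ((le_max_right _ _).trans hβ) hθ h8 hp hd
  exact ⟨β, (le_max_left _ _).trans hβ, L', h8', hp', hd'⟩

/-- **PXcof(θ) ↔ PXcof(1/24) for all `0 < θ ≤ 1/24`** (cofinal body): the registered tolerance of the 26930 slot is a representative. -/
theorem pinnedExitsCofinalAt_iff_24 {θ : ℝ} (hθ0 : 0 < θ) (hθ : θ ≤ 1 / 24) :
    (∀ (G : Type) [Group G] [TopologicalSpace G] [IsTopologicalGroup G] [CompactSpace G],
      IsCompactSimpleLieGroup G → SimplyConnectedSpace G →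
      letI : MeasurableSpace G := borel G
      haveI : BorelSpace G := ⟨rfl⟩
      ∀ (r : LatticeRep G) (a : ℝ → ℝ), (∀ β, 0 < a β) → Tendsto a atTop (𝓝 0) → LowerBounds G r a →
        ∃ T : ℝ, ∀ β₁ : ℝ, ∃ β : ℝ, β₁ ≤ β ∧ ∃ L : ℕ, 8 ≤ L ∧ a β * (L : ℝ) ≤ T ∧ coldDefect r.ρ β L ≤ θ) ↔
    (∀ (G : Type) [Group G] [TopologicalSpace G] [IsTopologicalGroup G] [CompactSpace G],
      IsCompactSimpleLieGroup G → SimplyConnectedSpace G →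
      letI : MeasurableSpace G := borel G
      haveI : BorelSpace G := ⟨rfl⟩
      ∀ (r : LatticeRep G) (a : ℝ → ℝ), (∀ β, 0 < a β) → Tendsto a atTop (𝓝 0) → LowerBounds G r a →
        ∃ T : ℝ, ∀ β₁ : ℝ, ∃ β : ℝ, β₁ ≤ β ∧ ∃ L : ℕ, 8 ≤ L ∧ a β * (L : ℝ) ≤ T ∧ coldDefect r.ρ β L ≤ 1 / 24) :=
  ⟨pinnedExitsCofinalAt_mono hθ, pinnedExitsCofinalAt_of_24 hθ0⟩

end Summit.QuantumFields.YangMills.Cruxes.IR.PinnedExit96.Tolerance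

end
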